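import Summits.AtomisticToContinuum.FouriersLaw.Theses.GriffithsLimitExchange

/-!
# `GriffithsLimitExchange.Assembly` — PROVED

Route `AtomisticToContinuum/FouriersLaw/GriffithsLimitExchange`, assembly item
`stmt-AtomisticToContinuum-13205` (`Assembly`):

  `BoundaryDEP → KernelIntegrable → FiniteHorizonTransmission → PositiveTransmission →
   VanishingSurvival → SandwichGlue → ResponseIdentity → NessUnique → FouriersLaw`.

The route file carries the planner-authored, sorry-free D-0027 §2.1 deciding theorem
`Summit.AtomisticToContinuum.FouriersLaw.Theses.GriffithsLimitExchange.closes`, whose type is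
literally the body of `Assembly` (same hypotheses, same order, conclusion `_root_.FouriersLaw`);
this file records the item-closing theorem whose type is the route decl `Assembly` by name.
For the mathematics (clause (i) of `FouriersLawFor` from the in-tree theorem
`pinnedChain_exists_isSteadyState` plus weak-NESS uniqueness `NessUnique`; clause (ii) from the
transmission law `(N-1)·γ·E_N → κ_b(T) > 0` produced by `SandwichGlue` out of the sign crux
`BoundaryDEP`, `KernelIntegrable` and the three finite-horizon cruxes, with `κ T := κ_b(T)` chosen
by `Classical.choose` and the difference-quotient limits `D_N = (N-1)·γ·E_N` supplied by
`ResponseIdentity`) see the proof of `closes` in the route file.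
No named-fact hypotheses: the theorem is unconditional (its axioms are those of `closes`:
`propext`, `Classical.choice`, `Quot.sound`).
-/

namespace Summit.AtomisticToContinuum.FouriersLaw.Theorems

/-- Settles `stmt-AtomisticToContinuum-13205` (assembly of route `GriffithsLimitExchange`): the
dynamical Griffiths sign crux `BoundaryDEP`, kernel integrability `KernelIntegrable`, the three
finite-horizon cruxes `FiniteHorizonTransmission`, `PositiveTransmission`, `VanishingSurvival`,
the real-analysis glue `SandwichGlue`, the KDN response identity `ResponseIdentity` and weak
steady-state uniqueness `NessUnique` imply the sub-problem statement `FouriersLaw`.  Proof: the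
route's deciding theorem `closes` (after unfolding `Assembly`). [folklore] -/
theorem griffithsLimitExchange_assembly_proof :
    Summit.AtomisticToContinuum.FouriersLaw.Theses.GriffithsLimitExchange.Assembly := by
  unfold Summit.AtomisticToContinuum.FouriersLaw.Theses.GriffithsLimitExchange.Assembly
  exact Summit.AtomisticToContinuum.FouriersLaw.Theses.GriffithsLimitExchange.closes

end Summit.AtomisticToContinuum.FouriersLaw.Theorems
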